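/-
Origin: expansion seat `prover-pub-hodgecm-mc-carch-1-g4-0`, handover #CA33 2026-08-20T08:12Z md5 9750ae32951e (310 l., 25 decls; NEW additive leaf; imports #CA32 (this kit) + RUN-44 #CA29 Model.ArchKTypeOfLambda + installed Model.ArchKTypeOfSlotRec, Model.ThetaAdelicSideEta, Model.ArchSideOfTwist (#P43a), Model.ArchKTypeOfLineOne (#CA21), Vendored…GelbartRogawski1991.CompatibleSplittingTwistVacuumShift; RUN 45; INSTALL after #CA32; cert certs/ax-ArchKTypeOfLineTables-9750ae32951e.log: rc 0 / 36 s / 0 warnings / 25/25 trio) (`HOME/mc/pub-hodgecm-mc-carch-1/pkg45/HodgeCM/Model/ArchKTypeOfLineTables.lean`, md5 9750ae32951e, 310 lines);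
landed by the gen-17 packager (p-g17) in gate run 45 as `HodgeCM/Model/ArchKTypeOfLineTables.lean` (verbatim).
-/
/-
Copyright (c) 2026. Released under Apache 2.0 license as described in the file LICENSE.
Cell pub-hodgecm, MODEL layer (construction prover mc-carch-1, gen 4), BINDER-OWNERS row 12 `C`, junction (C-Λ) § 5:
the LINE TABLES of the R1 read-off (types of ν₁ and χV) and the DEFINITE-PLACE sockets instantiated.
-/
import Summits.HodgeConjecture.HodgeCM.Model.ArchKTypeOfLambdaDef
import Summits.HodgeConjecture.HodgeCM.Model.ArchKTypeOfLambda
import Summits.HodgeConjecture.HodgeCM.Model.ArchKTypeOfSlotRec_2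
import Summits.HodgeConjecture.HodgeCM.Model.ThetaAdelicSideEta
import Summits.HodgeConjecture.HodgeCM.Model.ArchSideOfTwist
import Summits.HodgeConjecture.HodgeCM.Model.ArchKTypeOfLineOne
import Literature.NumberTheory.GelbartRogawski1991.CompatibleSplittingTwistVacuumShift

/-!
# (C-Λ) § 5: the line tables `n₁R` / `nVR` and the definite-place sockets at the R1 pin

With the exponents OF RECORD of the C lane — `defExponentZero/One` (the `det`-power tables of #CA20
`exists_defExponent_blockFamilyOfAt` for the two lines, one `Classical.choose` each), `lineVacExponentsZero/One … .eP` (#CA14), `lambdaExponent` (#CA29,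
the see-saw factor at `v₁`) and `defLambdaExponent` (#CA32, at the definite places) — this file DEFINES the two integer tables of the read-off

* **`n₁R V c … w`** `= −eP₁` at the place of `ι₁`, `= −a₁ (b w)` at the complex place over a real `b ≠ v₁` — the type of the twist `ν₁`;
* **`nVR V c … w`** `= −eP₀ − eP₁ − ℓ` at the place of `ι₁`, `= −a₀ (b w) − a₁ (b w) − ℓ_{b w}` elsewhere — the type of `χV`;

the R1 twist AS A BARE HOM **`νOf ν₁ V c := (EtaChi.η ν₁ ν₁ V c).comp (MonoidHom.inl _ _)`** (`x ↦ ν₁(det x)`) with its `hν`/`hνc` (`hνOf`, `hνcOf`: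
the shapes of #P43a `archSideOfT … ν hν hνc`), and proves the DEFINITE-PLACE half of the read-off: for `η := EtaChi.η χV χW V c`, `ν := νOf ν₁ V c`
with `HasArchType (χV V c) (nVR …)`, `HasArchType (ν₁ V c) (n₁R …)`:

* `etaT₀_archSingle_one` / `etaT₁_archSingle_one` — the η-parts of the two line scalars on a one-place element `archSingle (cmPlaceOver b) u` are
  `det(u)^{nVR (w b) − n₁R (w b)}` resp. `det(u)^{n₁R (w b)}` (K-1 `coe_cmDetTwistChar_archSingle_one`);
* **`hdef_zero_R1`** / **`hdef_one_R1`** — the `hdef` hypotheses of #CA27 `harch_zero/one_of_defTypeG` at `a := defExponentZero/One` HOLD, i.e. together with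
  `hω := defExponentZero/One_spec` the inputs `harch₀`/`harch₁` of the row-12 term at the R1 pin are THEOREMS ((c5)₀/(c5)₁ discharged at the
  definite places modulo nothing).

The `v₁` half ((χ)₀/(χ)₁: the section `archSectionFrameOf` under `(mk ι₁).embedding = ι₁`) is the sibling leaf (A2b).  0 records, 0 `def … : Prop`,
nothing cited as a hypothesis.
-/

set_option autoImplicit false

noncomputable section

open NumberField NumberField.InfinitePlace NumberField.mixedEmbedding IsDedekindDomain
open scoped Matrix Classical
open ComplexConjugate
open Literature.NumberTheory.Automorphic Literature.NumberTheory.Automorphic.UnitaryGroup Literature.NumberTheory.Weil1964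
open Literature.NumberTheory.GelbartRogawski1991 Literature.NumberTheory.GelbartRogawski1991.UnitaryDualPair
open Literature.RepresentationTheory.KonnoKonno2007
open Literature.Analysis.SegalBargmann
open HodgeCM.Adelic HodgeCM.PerL34 HodgeCM.Model.HypCensus HodgeCM.Model.ArchSideTerm

namespace HodgeCM.Model

section Tables

variable {L : CMField} {ι₁ : L →+* ℂ} (V : HermSpace3 L ι₁) (c : SeesawCtx L)
variable
  (hGR : (cmSplittingDatum (L : Type) finProdFinEquiv (frameD V) (frameD_real V) (frameD_ne V) (dW c.D) (dW_real c.D) (dW_ne c.D)).CompatibleSplitting)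
  (hGR₀ : (cmSplittingDatum (L : Type) (e₁) (frameD V) (frameD_real V) (frameD_ne V) (lineVec (L : Type) (dW c.D 0))
    (fun _ => dW_real c.D 0) (fun _ => dW_ne c.D 0)).CompatibleSplitting)
  (hGR₁ : (cmSplittingDatum (L : Type) (e₁) (frameD V) (frameD_real V) (frameD_ne V) (lineVec (L : Type) (dW c.D 1))
    (fun _ => dW_real c.D 1) (fun _ => dW_ne c.D 1)).CompatibleSplitting)
  (h₁W : (∀ j, 0 < (ι₁ (dW c.D j)).re) ∨ ∀ j, (ι₁ (dW c.D j)).re < 0)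
  (hpos₀ : 0 < cmXW (L : Type) (frameD V) (lineVec (L : Type) (dW c.D 0)) (fun _ => dW_real c.D 0) ι₁ (HypCensus.cmPlace (L : Type) ι₁) 0)
  (hpos₁ : 0 < cmXW (L : Type) (frameD V) (lineVec (L : Type) (dW c.D 1)) (fun _ => dW_real c.D 1) ι₁ (HypCensus.cmPlace (L : Type) ι₁) 0)

/-! ## § 1 The exponents of record at the definite places -/

/-- **`a₀ : {v real} → ℤ`, the `det`-power table OF RECORD of line 0** (one `Classical.choose` of #CA20 `exists_defExponent_blockFamilyOfAt`). -/
def defExponentZero : {v : InfinitePlace ↥(maximalRealSubfield L) // v.IsReal} → ℤ :=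
  (exists_defExponent_blockFamilyOfAt Empty V (dW c.D 0) (dW_real c.D 0) (dW_ne c.D 0) hGR₀ (posIdxEquivUnit hpos₀) (negIdxEquivEmpty hpos₀)).choose

/-- its defining property (= the `hω` hypothesis of #CA27 `harch_zero_of_defTypeG`). -/
theorem defExponentZero_spec :
    ∀ b : {v : InfinitePlace ↥(maximalRealSubfield L) // v.IsReal}, b ≠ HypCensus.cmPlace (L : Type) ι₁ →
      ∀ (u : archLocal (L : Type) 3 (Matrix.diagonal (frameD V)) (cmPlaceOver (L : Type) b)) (ℓ : Module.Dual ℂ (Fin 2 → ℂ)),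
        cmArchWeilRep (L : Type) e₁ (frameD V) (frameD_real V) (frameD_ne V) (lineVec (L : Type) (dW c.D 0)) (fun _ => dW_real c.D 0)
            (fun _ => dW_ne c.D 0) hGR₀
            (UnitaryGroup.archSingle (↥(maximalRealSubfield L)) L (IsCMField.complexConj L) 3 (Matrix.diagonal (frameD V))
              (IsCMField.complexConj_ne_one L) (UnitaryGroup.complexConj_smul_infinitePlace (L : Type)) (cmPlaceOver (L : Type) b) u, 1)
            (blockFamilyOfAt (L : Type) e₁ (frameD V) (frameD_real V) (frameD_ne V) (lineVec (L : Type) (dW c.D 0)) (fun _ => dW_real c.D 0)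
              (fun _ => dW_ne c.D 0) ι₁ (blockPosEquiv V) (blockNegEquiv V) (posIdxEquivUnit hpos₀) (negIdxEquivEmpty hpos₀) (degOnePDual Empty)
              (binvPi 1) ℓ) =
          (((u : archLocal (L : Type) 3 (Matrix.diagonal (frameD V)) (cmPlaceOver (L : Type) b)) : GL (Fin 3) ℂ) :
              Matrix (Fin 3) (Fin 3) ℂ).det ^ defExponentZero V c hGR₀ hpos₀ b •
            blockFamilyOfAt (L : Type) e₁ (frameD V) (frameD_real V) (frameD_ne V) (lineVec (L : Type) (dW c.D 0)) (fun _ => dW_real c.D 0)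
              (fun _ => dW_ne c.D 0) ι₁ (blockPosEquiv V) (blockNegEquiv V) (posIdxEquivUnit hpos₀) (negIdxEquivEmpty hpos₀) (degOnePDual Empty)
              (binvPi 1) ℓ :=
  (exists_defExponent_blockFamilyOfAt Empty V (dW c.D 0) (dW_real c.D 0) (dW_ne c.D 0) hGR₀ (posIdxEquivUnit hpos₀) (negIdxEquivEmpty hpos₀)).choose_spec

/-- **`a₁`, the `det`-power table OF RECORD of line 1.** -/
def defExponentOne : {v : InfinitePlace ↥(maximalRealSubfield L) // v.IsReal} → ℤ :=
  (exists_defExponent_blockFamilyOfAt Empty V (dW c.D 1) (dW_real c.D 1) (dW_ne c.D 1) hGR₁ (posIdxEquivUnit hpos₁) (negIdxEquivEmpty hpos₁)).choose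

/-- its defining property (= the `hω` hypothesis of #CA27 `harch_one_of_defTypeG`). -/
theorem defExponentOne_spec :
    ∀ b : {v : InfinitePlace ↥(maximalRealSubfield L) // v.IsReal}, b ≠ HypCensus.cmPlace (L : Type) ι₁ →
      ∀ (u : archLocal (L : Type) 3 (Matrix.diagonal (frameD V)) (cmPlaceOver (L : Type) b)) (ℓ : Module.Dual ℂ (Fin 2 → ℂ)),
        cmArchWeilRep (L : Type) e₁ (frameD V) (frameD_real V) (frameD_ne V) (lineVec (L : Type) (dW c.D 1)) (fun _ => dW_real c.D 1)
            (fun _ => dW_ne c.D 1) hGR₁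
            (UnitaryGroup.archSingle (↥(maximalRealSubfield L)) L (IsCMField.complexConj L) 3 (Matrix.diagonal (frameD V))
              (IsCMField.complexConj_ne_one L) (UnitaryGroup.complexConj_smul_infinitePlace (L : Type)) (cmPlaceOver (L : Type) b) u, 1)
            (blockFamilyOfAt (L : Type) e₁ (frameD V) (frameD_real V) (frameD_ne V) (lineVec (L : Type) (dW c.D 1)) (fun _ => dW_real c.D 1)
              (fun _ => dW_ne c.D 1) ι₁ (blockPosEquiv V) (blockNegEquiv V) (posIdxEquivUnit hpos₁) (negIdxEquivEmpty hpos₁) (degOnePDual Empty)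
              (binvPi 1) ℓ) =
          (((u : archLocal (L : Type) 3 (Matrix.diagonal (frameD V)) (cmPlaceOver (L : Type) b)) : GL (Fin 3) ℂ) :
              Matrix (Fin 3) (Fin 3) ℂ).det ^ defExponentOne V c hGR₁ hpos₁ b •
            blockFamilyOfAt (L : Type) e₁ (frameD V) (frameD_real V) (frameD_ne V) (lineVec (L : Type) (dW c.D 1)) (fun _ => dW_real c.D 1)
              (fun _ => dW_ne c.D 1) ι₁ (blockPosEquiv V) (blockNegEquiv V) (posIdxEquivUnit hpos₁) (negIdxEquivEmpty hpos₁) (degOnePDual Empty)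
              (binvPi 1) ℓ :=
  (exists_defExponent_blockFamilyOfAt Empty V (dW c.D 1) (dW_real c.D 1) (dW_ne c.D 1) hGR₁ (posIdxEquivUnit hpos₁) (negIdxEquivEmpty hpos₁)).choose_spec

/-! ## § 2 Complex places of `L` over real places of `L⁺` -/

/-- the real place of `L⁺` under a place `w` of `L`. -/
def placeUnder (w : InfinitePlace (L : Type)) : {v : InfinitePlace ↥(maximalRealSubfield L) // v.IsReal} :=
  ⟨w.comap (algebraMap (↥(maximalRealSubfield L)) L), IsTotallyReal.isReal _⟩

/-- the chosen complex place over `placeUnder w` is `w` (CM: one place over each real place). -/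
theorem cmPlaceOver_placeUnder (w : InfinitePlace (L : Type)) : (cmPlaceOver (L : Type) (placeUnder w)).1 = w := by
  rw [cmPlaceOver_eq_mk (L : Type) (placeUnder w) w.embedding (by rw [InfinitePlace.mk_embedding]; rfl), InfinitePlace.mk_embedding]

/-- (Ported verbatim from the HodgeCMPerL package; no docstring in the source.) -/
theorem placeUnder_cmPlaceOver (b : {v : InfinitePlace ↥(maximalRealSubfield L) // v.IsReal}) : placeUnder (cmPlaceOver (L : Type) b).1 = b :=
  Subtype.ext (cmPlaceOver_comap (L : Type) b)

/-- `placeUnder w = v₁ ↔ w` is the place of `ι₁`. -/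
theorem placeUnder_eq_cmPlace_iff (w : InfinitePlace (L : Type)) :
    placeUnder w = HypCensus.cmPlace (L : Type) ι₁ ↔ w = InfinitePlace.mk ι₁ := by
  constructor
  · intro h
    rw [← cmPlaceOver_placeUnder w, h]
    exact cmPlaceOver_eq_mk (L : Type) (HypCensus.cmPlace (L : Type) ι₁) ι₁ rfl
  · intro h
    subst h
    rfl

/-! ## § 3 The tables -/

/-- **the type table of the twist `ν₁` (line 1)**: `−eP₁` at the place of `ι₁`, `−a₁(b)` at the complex place over a real `b ≠ v₁`. -/
def n₁R (w : InfinitePlace (L : Type)) : ℤ :=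
  if placeUnder w = HypCensus.cmPlace (L : Type) ι₁ then
    -(lineVacExponentsOne V c hGR₁ h₁W (posIdxEquivUnit hpos₁) (negIdxEquivEmpty hpos₁)).eP
  else -defExponentOne V c hGR₁ hpos₁ (placeUnder w)

/-- **the type table of `χV` (line 0 carries `χV · ν₁⁻¹` and the see-saw factor)**: `−eP₀ − eP₁ − ℓ` at the place of `ι₁`,
`−a₀(b) − a₁(b) − ℓ_b` at the complex place over a real `b ≠ v₁`. -/
def nVR (w : InfinitePlace (L : Type)) : ℤ :=
  if h : placeUnder w = HypCensus.cmPlace (L : Type) ι₁ then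
    -(lineVacExponentsZero V c hGR₀ h₁W (posIdxEquivUnit hpos₀) (negIdxEquivEmpty hpos₀)).eP
      - (lineVacExponentsOne V c hGR₁ h₁W (posIdxEquivUnit hpos₁) (negIdxEquivEmpty hpos₁)).eP - lambdaExponent V c.D hGR hGR₀ hGR₁ h₁W
  else -defExponentZero V c hGR₀ hpos₀ (placeUnder w) - defExponentOne V c hGR₁ hpos₁ (placeUnder w) -
    defLambdaExponent V c.D hGR hGR₀ hGR₁ h₁W (placeUnder w) h

/-- (Ported verbatim from the HodgeCMPerL package; no docstring in the source.) -/
theorem n₁R_of_ne {b : {v : InfinitePlace ↥(maximalRealSubfield L) // v.IsReal}} (hb : b ≠ HypCensus.cmPlace (L : Type) ι₁) :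
    n₁R V c hGR₁ h₁W hpos₁ (cmPlaceOver (L : Type) b).1 = -defExponentOne V c hGR₁ hpos₁ b := by
  rw [n₁R, placeUnder_cmPlaceOver, if_neg hb]

/-- (Ported verbatim from the HodgeCMPerL package; no docstring in the source.) -/
theorem nVR_of_ne {b : {v : InfinitePlace ↥(maximalRealSubfield L) // v.IsReal}} (hb : b ≠ HypCensus.cmPlace (L : Type) ι₁) :
    nVR V c hGR hGR₀ hGR₁ h₁W hpos₀ hpos₁ (cmPlaceOver (L : Type) b).1 =
      -defExponentZero V c hGR₀ hpos₀ b - defExponentOne V c hGR₁ hpos₁ b - defLambdaExponent V c.D hGR hGR₀ hGR₁ h₁W b hb := by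
  unfold nVR
  rw [dif_neg (by rw [placeUnder_cmPlaceOver]; exact hb)]
  simp only [placeUnder_cmPlaceOver]

/-- (Ported verbatim from the HodgeCMPerL package; no docstring in the source.) -/
theorem n₁R_mk : n₁R V c hGR₁ h₁W hpos₁ (InfinitePlace.mk ι₁) =
    -(lineVacExponentsOne V c hGR₁ h₁W (posIdxEquivUnit hpos₁) (negIdxEquivEmpty hpos₁)).eP := by
  rw [n₁R, if_pos ((placeUnder_eq_cmPlace_iff _).mpr rfl)]

/-- (Ported verbatim from the HodgeCMPerL package; no docstring in the source.) -/
theorem nVR_mk : nVR V c hGR hGR₀ hGR₁ h₁W hpos₀ hpos₁ (InfinitePlace.mk ι₁) =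
    -(lineVacExponentsZero V c hGR₀ h₁W (posIdxEquivUnit hpos₀) (negIdxEquivEmpty hpos₀)).eP
      - (lineVacExponentsOne V c hGR₁ h₁W (posIdxEquivUnit hpos₁) (negIdxEquivEmpty hpos₁)).eP - lambdaExponent V c.D hGR hGR₀ hGR₁ h₁W := by
  rw [nVR, dif_pos ((placeUnder_eq_cmPlace_iff _).mpr rfl)]

end Tables

/-! ## § 4 The twist as a bare hom and the η-parts on one-place elements -/

section Twist

variable
  (χV χW ν₁ : ∀ {L : CMField} {ι₁ : L →+* ℂ} (_V : HermSpace3 L ι₁) (_c : SeesawCtx L),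
    ContinuousMonoidHom (Literature.NumberTheory.Automorphic.relNormOneIdeles (↥(NumberField.maximalRealSubfield (L : Type))) (L : Type) ⧸
      Literature.NumberTheory.Automorphic.relNormOneRat (↥(NumberField.maximalRealSubfield (L : Type))) (L : Type)) Circle)

/-- **the R1 twist as a bare hom**: `νOf ν₁ V c = (x ↦ ν₁(det x))` (`EtaChi.η ν₁ ν₁` read on the first factor). -/
def νOf {L : CMField} {ι₁ : L →+* ℂ} (V : HermSpace3 L ι₁) (c : SeesawCtx L) : CMAdelic (L : Type) (frameD V) →* ℂˣ :=
  (EtaChi.η @ν₁ @ν₁ V c).comp (MonoidHom.inl _ _)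

/-- (Ported verbatim from the HodgeCMPerL package; no docstring in the source.) -/
theorem νOf_apply {L : CMField} {ι₁ : L →+* ℂ} (V : HermSpace3 L ι₁) (c : SeesawCtx L) (x : CMAdelic (L : Type) (frameD V)) :
    νOf @ν₁ V c x = EtaChi.η @ν₁ @ν₁ V c (x, 1) := rfl

/-- `hν`: trivial on rational points. -/
theorem hνOf {L : CMField} {ι₁ : L →+* ℂ} (V : HermSpace3 L ι₁) (c : SeesawCtx L) :
    ∀ γU ∈ CMRat (L : Type) (frameD V), νOf @ν₁ V c γU = 1 :=
  fun γU hγ => EtaChi.hη @ν₁ @ν₁ V c γU hγ 1 (one_mem _)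

/-- `hνc`: continuous values. -/
theorem hνcOf {L : CMField} {ι₁ : L →+* ℂ} (V : HermSpace3 L ι₁) (c : SeesawCtx L) :
    Continuous fun v => ((νOf @ν₁ V c v : ℂˣ) : ℂ) :=
  (EtaChi.hηc @ν₁ @ν₁ V c).comp (continuous_id.prodMk continuous_const)

variable {L : CMField} {ι₁ : L →+* ℂ} (V : HermSpace3 L ι₁) (c : SeesawCtx L)
variable {nV n₁ : InfinitePlace (L : Type) → ℤ}

/-- the twist on a one-place element: `ν((archSingle w₀ u)^𝔸) = det(u)^{n₁ w₀}`. -/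
theorem νOf_archSingle (hn₁ : UnitaryLineChar.HasArchType (L : Type) (ν₁ V c) n₁) (w₀ : {w : InfinitePlace (L : Type) // w.IsComplex})
    (u : archLocal (L : Type) 3 (Matrix.diagonal (frameD V)) w₀) :
    ((νOf @ν₁ V c (UnitaryGroup.archToAdelic (↥(maximalRealSubfield L)) L (IsCMField.complexConj L) 3 (Matrix.diagonal (frameD V))
        (UnitaryGroup.archSingle (↥(maximalRealSubfield L)) L (IsCMField.complexConj L) 3 (Matrix.diagonal (frameD V))
          (IsCMField.complexConj_ne_one L) (UnitaryGroup.complexConj_smul_infinitePlace (L : Type)) w₀ u)) : ℂˣ) : ℂ) =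
      (((u : archLocal (L : Type) 3 (Matrix.diagonal (frameD V)) w₀) : GL (Fin 3) ℂ) : Matrix (Fin 3) (Fin 3) ℂ).det ^ n₁ w₀.1 :=
  coe_cmDetTwistChar_archSingle_one (L : Type) (frameD V) (frameD_ne V) (dW c.D) (dW_ne c.D) (ν₁ V c) (ν₁ V c) w₀ hn₁ u

/-- the Stage-B η on a one-place element: `η((archSingle w₀ u)^𝔸, 1) = det(u)^{nV w₀}`. -/
theorem eta_archSingle_one (hnV : UnitaryLineChar.HasArchType (L : Type) (χV V c) nV) (w₀ : {w : InfinitePlace (L : Type) // w.IsComplex})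
    (u : archLocal (L : Type) 3 (Matrix.diagonal (frameD V)) w₀) :
    ((EtaChi.η @χV @χW V c (UnitaryGroup.archToAdelic (↥(maximalRealSubfield L)) L (IsCMField.complexConj L) 3 (Matrix.diagonal (frameD V))
        (UnitaryGroup.archSingle (↥(maximalRealSubfield L)) L (IsCMField.complexConj L) 3 (Matrix.diagonal (frameD V))
          (IsCMField.complexConj_ne_one L) (UnitaryGroup.complexConj_smul_infinitePlace (L : Type)) w₀ u), 1) : ℂˣ) : ℂ) =
      (((u : archLocal (L : Type) 3 (Matrix.diagonal (frameD V)) w₀) : GL (Fin 3) ℂ) : Matrix (Fin 3) (Fin 3) ℂ).det ^ nV w₀.1 :=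
  coe_cmDetTwistChar_archSingle_one (L : Type) (frameD V) (frameD_ne V) (dW c.D) (dW_ne c.D) (χV V c) (χW V c) w₀ hnV u

end Twist

/-! ## § 5 The definite-place sockets at the R1 pin: (c5)₀ and (c5)₁ discharged -/

section R1Definite

variable
  (χV χW ν₁ : ∀ {L : CMField} {ι₁ : L →+* ℂ} (_V : HermSpace3 L ι₁) (_c : SeesawCtx L),
    ContinuousMonoidHom (Literature.NumberTheory.Automorphic.relNormOneIdeles (↥(NumberField.maximalRealSubfield (L : Type))) (L : Type) ⧸
      Literature.NumberTheory.Automorphic.relNormOneRat (↥(NumberField.maximalRealSubfield (L : Type))) (L : Type)) Circle)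
variable {L : CMField} {ι₁ : L →+* ℂ} (V : HermSpace3 L ι₁) (c : SeesawCtx L)
variable
  (hGR : (cmSplittingDatum (L : Type) finProdFinEquiv (frameD V) (frameD_real V) (frameD_ne V) (dW c.D) (dW_real c.D) (dW_ne c.D)).CompatibleSplitting)
  (hGR₀ : (cmSplittingDatum (L : Type) (e₁) (frameD V) (frameD_real V) (frameD_ne V) (lineVec (L : Type) (dW c.D 0))
    (fun _ => dW_real c.D 0) (fun _ => dW_ne c.D 0)).CompatibleSplitting)
  (hGR₁ : (cmSplittingDatum (L : Type) (e₁) (frameD V) (frameD_real V) (frameD_ne V) (lineVec (L : Type) (dW c.D 1))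
    (fun _ => dW_real c.D 1) (fun _ => dW_ne c.D 1)).CompatibleSplitting)
  (h₁W : (∀ j, 0 < (ι₁ (dW c.D j)).re) ∨ ∀ j, (ι₁ (dW c.D j)).re < 0)
  (hpos₀ : 0 < cmXW (L : Type) (frameD V) (lineVec (L : Type) (dW c.D 0)) (fun _ => dW_real c.D 0) ι₁ (HypCensus.cmPlace (L : Type) ι₁) 0)
  (hpos₁ : 0 < cmXW (L : Type) (frameD V) (lineVec (L : Type) (dW c.D 1)) (fun _ => dW_real c.D 1) ι₁ (HypCensus.cmPlace (L : Type) ι₁) 0)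

/-- (Ported verbatim from the HodgeCMPerL package; no docstring in the source.) -/
theorem det_archLocal_ne_zero {w₀ : {w : InfinitePlace (L : Type) // w.IsComplex}} (u : archLocal (L : Type) 3 (Matrix.diagonal (frameD V)) w₀) :
    (((u : archLocal (L : Type) 3 (Matrix.diagonal (frameD V)) w₀) : GL (Fin 3) ℂ) : Matrix (Fin 3) (Fin 3) ℂ).det ≠ 0 := by
  rw [← Matrix.GeneralLinearGroup.val_det_apply]
  exact Units.ne_zero _

/-- the η₁-part of the R1 line-1 scalar on a one-place element: `det(u)^{n₁R (w b)}`. -/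
theorem etaT₁_archSingle_one {n₁ : InfinitePlace (L : Type) → ℤ} (hn₁ : UnitaryLineChar.HasArchType (L : Type) (ν₁ V c) n₁)
    (w₀ : {w : InfinitePlace (L : Type) // w.IsComplex}) (u : archLocal (L : Type) 3 (Matrix.diagonal (frameD V)) w₀) :
    ((etaT₁ V c.D (EtaChi.η @χV @χW V c) (νOf @ν₁ V c)
        (UnitaryGroup.archToAdelic (↥(maximalRealSubfield L)) L (IsCMField.complexConj L) 3 (Matrix.diagonal (frameD V))
          (UnitaryGroup.archSingle (↥(maximalRealSubfield L)) L (IsCMField.complexConj L) 3 (Matrix.diagonal (frameD V))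
            (IsCMField.complexConj_ne_one L) (UnitaryGroup.complexConj_smul_infinitePlace (L : Type)) w₀ u), 1) : ℂˣ) : ℂ) =
      (((u : archLocal (L : Type) 3 (Matrix.diagonal (frameD V)) w₀) : GL (Fin 3) ℂ) : Matrix (Fin 3) (Fin 3) ℂ).det ^ n₁ w₀.1 := by
  rw [etaT₁_apply_mk_one, νOf_archSingle @ν₁ V c hn₁]

/-- the η₀-part of the R1 line-0 scalar on a one-place element: `det(u)^{nV (w b) − n₁ (w b)}`. -/
theorem etaT₀_archSingle_one {nV n₁ : InfinitePlace (L : Type) → ℤ} (hnV : UnitaryLineChar.HasArchType (L : Type) (χV V c) nV)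
    (hn₁ : UnitaryLineChar.HasArchType (L : Type) (ν₁ V c) n₁)
    (w₀ : {w : InfinitePlace (L : Type) // w.IsComplex}) (u : archLocal (L : Type) 3 (Matrix.diagonal (frameD V)) w₀) :
    ((etaT₀ V c.D (EtaChi.η @χV @χW V c) (νOf @ν₁ V c)
        (UnitaryGroup.archToAdelic (↥(maximalRealSubfield L)) L (IsCMField.complexConj L) 3 (Matrix.diagonal (frameD V))
          (UnitaryGroup.archSingle (↥(maximalRealSubfield L)) L (IsCMField.complexConj L) 3 (Matrix.diagonal (frameD V))
            (IsCMField.complexConj_ne_one L) (UnitaryGroup.complexConj_smul_infinitePlace (L : Type)) w₀ u), 1) : ℂˣ) : ℂ) =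
      (((u : archLocal (L : Type) 3 (Matrix.diagonal (frameD V)) w₀) : GL (Fin 3) ℂ) : Matrix (Fin 3) (Fin 3) ℂ).det ^ (nV w₀.1 - n₁ w₀.1) := by
  rw [etaT₀_apply_mk_one, Units.val_mul, Units.val_inv_eq_inv_val, νOf_archSingle @ν₁ V c hn₁, eta_archSingle_one @χV @χW V c hnV,
    ← zpow_neg, ← zpow_add₀ (det_archLocal_ne_zero V u)]
  congr 1
  ring

variable (hnV : UnitaryLineChar.HasArchType (L : Type) (χV V c) (nVR V c hGR hGR₀ hGR₁ h₁W hpos₀ hpos₁))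
  (hn₁ : UnitaryLineChar.HasArchType (L : Type) (ν₁ V c) (n₁R V c hGR₁ h₁W hpos₁))

include hn₁ in
/-- **(c5)₁ AT THE R1 PIN: the `hdef` hypothesis of #CA27 `harch_one_of_defTypeG` HOLDS** for `η₁ := etaT₁ … (EtaChi.η χV χW V c) (νOf ν₁ V c)`,
`a := defExponentOne` and `ν₁` of type `n₁R`. -/
theorem hdef_one_R1 :
    ∀ b : {v : InfinitePlace ↥(maximalRealSubfield L) // v.IsReal}, b ≠ HypCensus.cmPlace (L : Type) ι₁ →
      ∀ u : UnitaryGroup.archLocal (L : Type) 3 (Matrix.diagonal (frameD V)) (cmPlaceOver (L : Type) b),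
        ((archScalar_oneG V c.D hGR hGR₀ hGR₁ (etaT₁ V c.D (EtaChi.η @χV @χW V c) (νOf @ν₁ V c))
            (UnitaryGroup.archSingle (↥(maximalRealSubfield L)) L (IsCMField.complexConj L) 3 (Matrix.diagonal (frameD V))
              (IsCMField.complexConj_ne_one L) (NumberField.complexConj_smul_infinitePlace (L : Type)) (cmPlaceOver (L : Type) b) u) : ℂˣ) : ℂ) *
          (((u : UnitaryGroup.archLocal (L : Type) 3 (Matrix.diagonal (frameD V)) (cmPlaceOver (L : Type) b)) : GL (Fin 3) ℂ) :
              Matrix (Fin 3) (Fin 3) ℂ).det ^ defExponentOne V c hGR₁ hpos₁ b = 1 := by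
  intro b hb u
  rw [archScalar_one_applyG, etaT₁_def, twist_eta₁_mul_cmLineChar₁_apply, νOf_archSingle @ν₁ V c hn₁, n₁R_of_ne V c hGR₁ h₁W hpos₁ hb,
    ← zpow_add₀ (det_archLocal_ne_zero V u), neg_add_cancel, zpow_zero]

include hnV hn₁ in
/-- **(c5)₀ AT THE R1 PIN: the `hdef` hypothesis of #CA27 `harch_zero_of_defTypeG` HOLDS** for `η₀ := etaT₀ … (EtaChi.η χV χW V c) (νOf ν₁ V c)`,
`a := defExponentZero`, `χV` of type `nVR` and `ν₁` of type `n₁R` (the see-saw factor absorbed by `ℓ_b` through #CA32). -/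
theorem hdef_zero_R1 :
    ∀ b : {v : InfinitePlace ↥(maximalRealSubfield L) // v.IsReal}, b ≠ HypCensus.cmPlace (L : Type) ι₁ →
      ∀ u : UnitaryGroup.archLocal (L : Type) 3 (Matrix.diagonal (frameD V)) (cmPlaceOver (L : Type) b),
        ((archScalar_zeroG V c.D hGR hGR₀ hGR₁ (etaT₀ V c.D (EtaChi.η @χV @χW V c) (νOf @ν₁ V c))
            (UnitaryGroup.archSingle (↥(maximalRealSubfield L)) L (IsCMField.complexConj L) 3 (Matrix.diagonal (frameD V))
              (IsCMField.complexConj_ne_one L) (NumberField.complexConj_smul_infinitePlace (L : Type)) (cmPlaceOver (L : Type) b) u) : ℂˣ) : ℂ) *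
          (((u : UnitaryGroup.archLocal (L : Type) 3 (Matrix.diagonal (frameD V)) (cmPlaceOver (L : Type) b)) : GL (Fin 3) ℂ) :
              Matrix (Fin 3) (Fin 3) ℂ).det ^ defExponentZero V c hGR₀ hpos₀ b = 1 :=
  hdef_zero_of_archType V c.D hGR hGR₀ hGR₁ (etaT₀ V c.D (EtaChi.η @χV @χW V c) (νOf @ν₁ V c)) h₁W (defExponentZero V c hGR₀ hpos₀)
    (fun b => nVR V c hGR hGR₀ hGR₁ h₁W hpos₀ hpos₁ (cmPlaceOver (L : Type) b).1 - n₁R V c hGR₁ h₁W hpos₁ (cmPlaceOver (L : Type) b).1)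
    (fun b _ u => etaT₀_archSingle_one @χV @χW @ν₁ V c hnV hn₁ (cmPlaceOver (L : Type) b) u)
    (fun b hb => by rw [nVR_of_ne V c hGR hGR₀ hGR₁ h₁W hpos₀ hpos₁ hb, n₁R_of_ne V c hGR₁ h₁W hpos₁ hb]; ring)

end R1Definite

end HodgeCM.Model

end
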